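import Mathlib
import HarnessLib

/-!
# `NoHeavyLowerTail` (crux stmt-CriticalPhenomena-4575), antithetic vdBHK programme: the DOUBLY-CERTIFIED LEVEL (core of LEMMA D2)

Support file (seat `prim-ineq-gen-7` gen 42; `--supports stmt-CriticalPhenomena-4575`).  Nothing is asserted about the crux; no `sorry`,
no definitions.  Memo: run/shared/lean/prim/prim-ineq-gen-7/FINDING-ROOTLEAF-g42.md §2.

CONTEXT.  In the reduction `(***)_T ⟹ RAA(unicyclic)` (FINDING-TREEBLOCK-g25) every certified level `ρ` of a block contributes
`Δ_N(A^ρ,B^ρ) ≥ 1` because one antipodal pair `{z, w} = {V_k, W_{n−k}}` of the cycle poset `T_n` can be inserted (`A^ρ ∪ {z}`, `B^ρ ∪ {w}` are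
up-sets).  Gen 42's TYPED reduction needs `Δ_N ≥ 2` at a DOUBLY certified level, where BOTH insertions (`z` into `A`, `w` into `B`) and
(`w` into `A`, `z` into `B`) are valid.  LEMMA D2 of the memo: since every element of `T_n ∖ {z,w}` is comparable with `z` or `w`
(structure lemma, from the g20/g22 generating relations; machine-checked n ≤ 15), the two validity conditions force
`A^ρ = B^ρ = U :=` the elements strictly above `z` or `w`, and `ι U` lies strictly below, so `Δ_N(A^ρ,B^ρ) = |U|` (`= 2n−3` in `T_n`,
`≥ n−1 ≥ 2` after removing the other blocks' pairs, `n ≥ 3`).  This file is the abstract core: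
* `AntitheticDoubleLevel.eq_upper_of_double` — in a partial order in which every element other than `z, w` is comparable with `z` or `w`,
  a set avoiding `z, w`, containing everything strictly above them and nothing below them IS the strict upper part `U`;
* `AntitheticDoubleLevel.delta_double_level` — for an antitone `ι` swapping `z, w`, and such `A, B`:
  `#(A ∩ B) − #{x ∈ A : ι x ∈ B} = #U`.
-/

namespace Summit.CriticalPhenomena.PercolationContinuityZ3.Theorems

open Finset

namespace AntitheticDoubleLevel

variable {P : Type*} [Fintype P] [DecidableEq P] [PartialOrder P] [DecidableRel (α := P) (· ≤ ·)]

/-- Forcing: if every element other than `z, w` is comparable with `z` or `w`, then a finset `A` that avoids `z, w`, contains every element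
strictly above `z` or `w`, and contains no element below `z` or `w`, equals the strict upper part
`U = {x ≠ z, w : z ≤ x ∨ w ≤ x}`. [this work] -/
theorem eq_upper_of_double (z w : P) (A : Finset P)
    (hcomp : ∀ x, x ≠ z → x ≠ w → (z ≤ x ∨ w ≤ x ∨ x ≤ z ∨ x ≤ w))
    (hz : z ∉ A) (hw : w ∉ A)
    (hup : ∀ x, x ≠ z → x ≠ w → (z ≤ x ∨ w ≤ x) → x ∈ A)
    (hdown : ∀ x ∈ A, ¬ x ≤ z ∧ ¬ x ≤ w) :
    A = univ.filter (fun x => x ≠ z ∧ x ≠ w ∧ (z ≤ x ∨ w ≤ x)) := by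
  ext x
  simp only [mem_filter, mem_univ, true_and]
  constructor
  · intro hx
    have hxz : x ≠ z := fun h => hz (h ▸ hx)
    have hxw : x ≠ w := fun h => hw (h ▸ hx)
    refine ⟨hxz, hxw, ?_⟩
    rcases hcomp x hxz hxw with h | h | h | h
    · exact Or.inl h
    · exact Or.inr h
    · exact absurd h (hdown x hx).1
    · exact absurd h (hdown x hx).2
  · rintro ⟨hxz, hxw, h⟩
    exact hup x hxz hxw h

/-- **LEMMA D2 (abstract core).**  Let `ι` be antitone with `ι z = w`, `ι w = z`, and suppose every element other than `z, w`
is comparable with `z` or `w`.  If `A` and `B` both avoid `z, w`, contain everything strictly above `z` or `w` and nothing below `z` or `w`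
(the conditions making BOTH antipodal insertions valid), then `#(A ∩ B) − #{x ∈ A : ι x ∈ B} = #U`: the doubly-certified level contributes
the full size of the strict upper part (no cancellation, because `ι` maps `U` strictly below `z, w`). [this work] -/
theorem delta_double_level (ι : P → P) (hanti : ∀ x y : P, x ≤ y → ι y ≤ ι x) (z w : P) (hιz : ι z = w)
    (hcomp : ∀ x, x ≠ z → x ≠ w → (z ≤ x ∨ w ≤ x ∨ x ≤ z ∨ x ≤ w))
    (hιw : ι w = z)
    (A B : Finset P)
    (hzA : z ∉ A) (hwA : w ∉ A) (hupA : ∀ x, x ≠ z → x ≠ w → (z ≤ x ∨ w ≤ x) → x ∈ A) (hdownA : ∀ x ∈ A, ¬ x ≤ z ∧ ¬ x ≤ w)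
    (hzB : z ∉ B) (hwB : w ∉ B) (hupB : ∀ x, x ≠ z → x ≠ w → (z ≤ x ∨ w ≤ x) → x ∈ B) (hdownB : ∀ x ∈ B, ¬ x ≤ z ∧ ¬ x ≤ w) :
    ((A ∩ B).card : ℤ) - ((A.filter (fun x => ι x ∈ B)).card : ℤ)
      = ((univ.filter (fun x => x ≠ z ∧ x ≠ w ∧ (z ≤ x ∨ w ≤ x))).card : ℤ) := by
  have hA := eq_upper_of_double z w A hcomp hzA hwA hupA hdownA
  have hB := eq_upper_of_double z w B hcomp hzB hwB hupB hdownB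
  -- no element of A has its antipode in B
  have hempty : A.filter (fun x => ι x ∈ B) = ∅ := by
    apply Finset.filter_eq_empty_iff.mpr
    intro x hx hιx
    have hxup : z ≤ x ∨ w ≤ x := by
      have := hx; rw [hA] at this; simp only [mem_filter, mem_univ, true_and] at this; exact this.2.2
    have hdn := hdownB (ι x) hιx
    rcases hxup with h | h
    · exact hdn.2 (hιz ▸ hanti z x h)
    · exact hdn.1 (hιw ▸ hanti w x h)
  rw [hempty, Finset.card_empty, hA, hB, Finset.inter_self]
  simp

end AntitheticDoubleLevel

end Summit.CriticalPhenomena.PercolationContinuityZ3.Theorems
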